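import Summits.QuantumFields.YangMills.Theorems.RevelationMartingaleFreshVertexZeroIncrementT3
import HarnessLib

/-!
# Route RevelationMartingale — TREE ENUMERATION: the torus graph is connected, so a «spanning tree first» bond enumeration EXISTS,
# and along it the revelation martingale of a gauge-invariant observable is constant for the first `#Site − 1` steps

Cell `ym3-torus` (YM ladder rung R3 = continuum SU(2) Yang–Mills on the three-torus — a RUNG, NOT d = 4, NOT the Clay problem), width
seat `ym-ust-19936-w4` gen 9; line «revelation_martingale» on the crux `HistoryTailL` (stmt-QuantumFields-19936); helper file,
`--supports stmt-QuantumFields-19936`.  Combinatorial complement of ✓`RevelationMartingaleFreshVertexZeroIncrement(T3)` (the TREE-GAUGE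
zero-increment theorems): those are stated for an arbitrary enumeration `e` under a «fresh vertex» ∕ «leaf-by-leaf prefix» hypothesis;
this file shows such enumerations EXIST with the longest possible free prefix, `#Site − 1` bonds (a spanning tree), so that the
existential `∃ N e, Surjective e ∧ …` of LINE 13's bond stubs (`stub_levelOneBondRevelation` ∕ `stub_higherBondRevelation`) can be
instantiated «spanning tree first» with the first `#Site − 1` proxies `σ_i := 0` by kernel, not by docstring.

* §1 (any `Params`, any level `j`) `add_natCast_mem_of_shift_closed`, ★`eq_univ_of_shift_closed` — THE TORUS GRAPH IS CONNECTED: a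
  nonempty set of sites closed under the `d` unit shifts `x ↦ x + e_μ` is everything (iterate the shift `(y_κ − x_κ).val` times in each
  coordinate; `ZMod.natCast_zmod_val`); ★`exists_shift_not_mem` — every nonempty proper set of sites has an outgoing unit bond.
* §2 `exists_freshList` — growing a spanning tree one fresh vertex at a time (induction on the number of bonds, §1 supplies the next
  bond `⟨x, μ⟩` with `x` reached and `x + e_μ` new); ★★`exists_bondEnumeration_treeFirst` — `∃ N (e : Fin N → PBond P 0)`, ONTO, whose
  first `#Site − 1` bonds each have an endpoint (the final point) touched by no earlier bond — literally the hypothesis `hforest` of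
  ✓`condExp_bondReveal_ae_eq_integral_of_forestPrefix` with `i₀ = #Site − 1` (tree list, then all bonds appended; `Finset.toList`).
* §3 ★★`exists_bondEnumeration_condExp_const_prefix_T3` — BY NAME with ✓`condExp_bondReveal_ae_eq_integral_of_forestPrefix_T3`: for
  `gibbsK F ℰp γ K` (`0 ≤ γ`) and `f = dist1(Ū^j(∂p))` (`j ≤ m + K`) there is an admissible (onto) enumeration of the finest bonds along
  whose bond-revelation filtration `μ[f | ℱ i] = E_μ f` a.e. for every `i ≤ #Site − 1`.

COUNT: `#Site = n³`, `#PBond = 3n³` on the level-0 torus (`n = sitesPerDir 0 = 2L^(m+K)`, `d = 3`), so after the free prefix at most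
`#PBond − (#Site − 1) = 2n³ + 1` indices can carry a non-zero proxy.  HONEST SCOPE: graph combinatorics + the tree-gauge theorems; nothing
about the loop-closing increments, the window, the sum `≤ Cv·g_(K−j)²`, 23082, the stubs, `HistoryTailL` or a summit statement.
Mathlib + tree only; def-free. [folklore]
-/

namespace Summit.QuantumFields.YangMills.Theorems.RevelationMartingaleTreeGauge

open scoped BigOperators Classical MeasureTheory
open MeasureTheory Set Filter Literature.MathematicalPhysics.QuantumFieldTheory.Balaban1983to89
  Literature.MathematicalPhysics.QuantumFieldTheory.Balaban1983to89.T3ContinuumYM3Torus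

/-! ## §1 The torus graph is connected -/

section Connected

variable {P : Params} {j : ℕ}

/-- Translating a site by a vector of natural numbers, one unit shift at a time: if `S` is closed under the `d` unit shifts then it
is closed under all translations `x ↦ (κ ↦ x κ + c κ)`. [folklore] -/
theorem add_natCast_mem_of_shift_closed {S : Finset (Site P j)} (hS : ∀ x ∈ S, ∀ μ : Fin P.d, x.shift μ ∈ S)
    {x : Site P j} (hx : x ∈ S) (c : Fin P.d → ℕ) :
    (fun κ => x κ + ((c κ : ℕ) : ZMod (P.sitesPerDir j))) ∈ S := by
  suffices h : ∀ (s : ℕ) (c : Fin P.d → ℕ), ∑ κ, c κ = s → (fun κ => x κ + ((c κ : ℕ) : ZMod (P.sitesPerDir j))) ∈ S from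
    h _ c rfl
  intro s
  induction s using Nat.strong_induction_on with
  | _ s ih =>
    intro c hc
    by_cases h0 : ∀ κ, c κ = 0
    · have : (fun κ => x κ + ((c κ : ℕ) : ZMod (P.sitesPerDir j))) = x := by
        funext κ; simp [h0 κ]
      rw [this]; exact hx
    · push Not at h0
      obtain ⟨κ₀, hκ₀⟩ := h0
      have hpos : 0 < c κ₀ := Nat.pos_of_ne_zero hκ₀
      -- remove one unit in direction `κ₀`
      set c' : Fin P.d → ℕ := Function.update c κ₀ (c κ₀ - 1) with hc'
      have hsum' : ∑ κ, c' κ < s := by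
        have h1 : ∑ κ, c' κ + 1 = ∑ κ, c κ := by
          have hsplit := Finset.sum_update_of_mem (Finset.mem_univ κ₀) c (c κ₀ - 1)
          -- `∑ update = (c κ₀ - 1) + ∑_{κ ≠ κ₀} c κ`
          rw [hc', hsplit]
          have h2 : ∑ κ ∈ Finset.univ, c κ = c κ₀ + ∑ κ ∈ Finset.univ \ {κ₀}, c κ := by
            rw [← Finset.add_sum_erase _ _ (Finset.mem_univ κ₀), Finset.sdiff_singleton_eq_erase]
          rw [h2]; omega
        omega
      have hmem := ih _ hsum' c' rfl
      have hstep := hS _ hmem κ₀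
      have heq : Site.shift (fun κ => x κ + ((c' κ : ℕ) : ZMod (P.sitesPerDir j))) κ₀ =
          fun κ => x κ + ((c κ : ℕ) : ZMod (P.sitesPerDir j)) := by
        funext κ
        by_cases hκ : κ = κ₀
        · subst hκ
          simp only [Site.shift, Function.update_self, hc']
          have : ((c κ - 1 : ℕ) : ZMod (P.sitesPerDir j)) + 1 = ((c κ : ℕ) : ZMod (P.sitesPerDir j)) := by
            rw [← Nat.cast_succ, Nat.succ_eq_add_one, Nat.sub_add_cancel hpos]
          rw [add_assoc, this]
        · simp only [Site.shift, Function.update_of_ne hκ, hc']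
      rw [heq] at hstep
      exact hstep

/-- **THE TORUS GRAPH IS CONNECTED**: a nonempty set of sites closed under the `d` unit shifts is everything. [folklore] -/
theorem eq_univ_of_shift_closed {S : Finset (Site P j)} (hne : S.Nonempty) (hS : ∀ x ∈ S, ∀ μ : Fin P.d, x.shift μ ∈ S) :
    S = Finset.univ := by
  obtain ⟨x, hx⟩ := hne
  refine Finset.eq_univ_of_forall fun y => ?_
  have h := add_natCast_mem_of_shift_closed hS hx (fun κ => (y κ - x κ).val)
  have heq : (fun κ => x κ + ((((y κ - x κ).val : ℕ)) : ZMod (P.sitesPerDir j))) = y := by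
    funext κ; rw [ZMod.natCast_zmod_val]; abel
  rwa [heq] at h

/-- … hence every nonempty PROPER set of sites has an OUTGOING unit bond `⟨x, x + e_μ⟩`, `x ∈ S`, `x + e_μ ∉ S`. [folklore] -/
theorem exists_shift_not_mem {S : Finset (Site P j)} (hne : S.Nonempty) (hS : S ≠ Finset.univ) :
    ∃ x ∈ S, ∃ μ : Fin P.d, x.shift μ ∉ S := by
  by_contra h
  push Not at h
  exact hS (eq_univ_of_shift_closed hne h)

end Connected

/-! ## §2 A «spanning tree first» enumeration of the bonds -/

section Enumeration

variable {P : Params}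

/-- GROWING A SPANNING TREE ONE FRESH VERTEX AT A TIME: for every `k < #Site` there is a list of `k` bonds, each of which has its
final point touched by no earlier bond of the list, whose endpoints together with the root fill a set of exactly `k + 1` sites.
[folklore] -/
theorem exists_freshList (k : ℕ) (hk : k + 1 ≤ Fintype.card (Site P 0)) :
    ∃ (l : List (PBond P 0)) (S : Finset (Site P 0)), l.length = k ∧ S.card = k + 1 ∧
      (∀ b ∈ l, b.src ∈ S ∧ b.tgt ∈ S) ∧
      ∀ (i : ℕ) (hi : i < l.length), ∀ (m : ℕ) (hm : m < i),
        (l[m]'(hm.trans hi)).src ≠ (l[i]'hi).tgt ∧ (l[m]'(hm.trans hi)).tgt ≠ (l[i]'hi).tgt := by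
  induction k with
  | zero =>
      refine ⟨[], {default}, rfl, Finset.card_singleton _, fun b hb => absurd hb (List.not_mem_nil), ?_⟩
      intro i hi; exact absurd hi (Nat.not_lt_zero _)
  | succ k ih =>
      obtain ⟨l, S, hlen, hcard, hin, hfresh⟩ := ih (Nat.le_of_succ_le hk)
      have hne : S.Nonempty := Finset.card_pos.mp (by omega)
      have hS : S ≠ Finset.univ := by
        intro h
        have : S.card = Fintype.card (Site P 0) := by rw [h, Finset.card_univ]
        omega
      obtain ⟨x, hx, μ, hxμ⟩ := exists_shift_not_mem hne hS
      refine ⟨l ++ [⟨x, μ⟩], insert (x.shift μ) S, by simp [hlen], by rw [Finset.card_insert_of_notMem hxμ, hcard], ?_, ?_⟩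
      · intro b hb
        rcases List.mem_append.mp hb with hb | hb
        · exact ⟨Finset.mem_insert_of_mem (hin b hb).1, Finset.mem_insert_of_mem (hin b hb).2⟩
        · rw [List.mem_singleton] at hb
          subst hb
          exact ⟨Finset.mem_insert_of_mem hx, Finset.mem_insert_self _ _⟩
      · intro i hi m hm
        have hm' : m < l.length := by
          rw [List.length_append, List.length_singleton] at hi; omega
        have hlm : (l ++ [(⟨x, μ⟩ : PBond P 0)])[m]'(hm.trans hi) = l[m]'hm' := List.getElem_append_left hm'
        by_cases hil : i < l.length
        · have hli : (l ++ [(⟨x, μ⟩ : PBond P 0)])[i]'hi = l[i]'hil := List.getElem_append_left hil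
          rw [hlm, hli]
          exact hfresh i hil m hm
        · have hieq : i = l.length := by
            rw [List.length_append, List.length_singleton] at hi; omega
          have hli : (l ++ [(⟨x, μ⟩ : PBond P 0)])[i]'hi = ⟨x, μ⟩ := by
            subst hieq
            rw [List.getElem_append_right (le_refl _)]
            simp
          rw [hlm, hli]
          have hmem : l[m]'hm' ∈ l := List.getElem_mem hm'
          have h1 := (hin _ hmem).1
          have h2 := (hin _ hmem).2
          exact ⟨fun h => hxμ (by rw [h] at h1; exact h1), fun h => hxμ (by rw [h] at h2; exact h2)⟩

/-- **A «SPANNING TREE FIRST» ENUMERATION OF THE BONDS EXISTS**: an enumeration `e : Fin N → PBond P 0` of ALL finest bonds (onto)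
whose first `#Site − 1` bonds each have an endpoint touched by no earlier bond — the hypothesis `hforest` of
✓`condExp_bondReveal_ae_eq_integral_of_forestPrefix` with `i₀ = #Site − 1`. [folklore] -/
theorem exists_bondEnumeration_treeFirst (P : Params) :
    ∃ (N : ℕ) (e : Fin N → PBond P 0), Function.Surjective e ∧ ∃ hV : Fintype.card (Site P 0) - 1 ≤ N,
      ∀ (i : ℕ) (hi : i < Fintype.card (Site P 0) - 1), ∃ x : Site P 0,
        ((e ⟨i, lt_of_lt_of_le hi hV⟩).src = x ∨ (e ⟨i, lt_of_lt_of_le hi hV⟩).tgt = x) ∧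
        ∀ m : Fin N, (m : ℕ) < i → (e m).src ≠ x ∧ (e m).tgt ≠ x := by
  have hV : Fintype.card (Site P 0) - 1 + 1 ≤ Fintype.card (Site P 0) := by
    have : 0 < Fintype.card (Site P 0) := Fintype.card_pos
    omega
  obtain ⟨t, S, hlen, -, -, hfresh⟩ := exists_freshList (P := P) (Fintype.card (Site P 0) - 1) hV
  set all : List (PBond P 0) := (Finset.univ : Finset (PBond P 0)).toList with hall
  refine ⟨(t ++ all).length, fun i => (t ++ all)[(i : ℕ)]'i.2, ?_, ?_, ?_⟩
  · intro b
    have hb : b ∈ t ++ all := List.mem_append.mpr (Or.inr (by rw [hall, Finset.mem_toList]; exact Finset.mem_univ b))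
    obtain ⟨n, hn, hnb⟩ := List.mem_iff_getElem.mp hb
    exact ⟨⟨n, hn⟩, hnb⟩
  · rw [List.length_append, hlen]; omega
  · intro i hi
    have hit : i < t.length := by rw [hlen]; exact hi
    refine ⟨(t[i]'hit).tgt, Or.inr ?_, fun m hm => ?_⟩
    · simp only [List.getElem_append_left hit]
    · have hmt : (m : ℕ) < t.length := lt_trans hm hit
      simp only [List.getElem_append_left hmt]
      exact hfresh i hit m hm

end Enumeration

/-! ## §3 By name: the revelation martingale of `dist1(Ū^j(∂p))` under `gibbsK` is constant along a tree prefix -/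

section T3

/-- **TREE FIRST, NOTHING MOVES** (LINE 13's «spanning tree first — zero increments by gauge invariance», existential form in the
stubs' letters): for the Wilson–Gibbs law `gibbsK F ℰp γ K` (`0 ≤ γ`) and `f = dist1(Ū^j(∂p))` (`j ≤ m + K`) there IS an admissible
enumeration of the finest bonds (onto, as the bond stubs require) such that for THE bond-revelation filtration `ℱ` of it the
conditional expectations `μ[f | ℱ i]` are a.e. EQUAL TO THE MEAN for every `i ≤ #Site − 1`: the first `#Site − 1` Doob increments
vanish, so at most `#PBond − #Site + 1` proxies of `stub_levelOneBondRevelation` ∕ `stub_higherBondRevelation` need be non-zero. [folklore] -/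
theorem exists_bondEnumeration_condExp_const_prefix_T3 (F : T3Family) {γ : ℝ} (hγ : 0 ≤ γ) (K j : ℕ) (hj : j ≤ F.m + K)
    (p : Plaq (F.P K) j) :
    ∃ (N : ℕ) (e : Fin N → PBond (F.P K) 0), Function.Surjective e ∧ Fintype.card (Site (F.P K) 0) - 1 ≤ N ∧
      ∀ ℱ : MeasureTheory.Filtration ℕ
          (inferInstance : MeasurableSpace (GaugeField (F.P K) 0 (Matrix.specialUnitaryGroup (Fin 2) ℂ))),
        (∀ i, ℱ i = MeasurableSpace.comap
          (fun (U : GaugeField (F.P K) 0 (Matrix.specialUnitaryGroup (Fin 2) ℂ)) (m : Fin N) =>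
            if (m : ℕ) < i then U (e m) else (1 : Matrix.specialUnitaryGroup (Fin 2) ℂ)) inferInstance) →
        ∀ i, i ≤ Fintype.card (Site (F.P K) 0) - 1 →
          MeasureTheory.condExp (ℱ i) (T3UnitScaleTilt.gibbsK F T3UnitLawDensityEML.ℰp γ K)
              (fun V => GaugeGroup.dist1 (GaugeField.plaqHol
                (Averaging.iter (fun i => BlockAveraging.blockAvg (P := F.P K) (j := i) T3UnitLawDensityEML.ℰp) j V) p))
            =ᵐ[T3UnitScaleTilt.gibbsK F T3UnitLawDensityEML.ℰp γ K]
          fun _ => ∫ V, GaugeGroup.dist1 (GaugeField.plaqHol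
                (Averaging.iter (fun i => BlockAveraging.blockAvg (P := F.P K) (j := i) T3UnitLawDensityEML.ℰp) j V) p)
              ∂(T3UnitScaleTilt.gibbsK F T3UnitLawDensityEML.ℰp γ K) := by
  obtain ⟨N, e, he, hV, hforest⟩ := exists_bondEnumeration_treeFirst (F.P K)
  exact ⟨N, e, he, hV, fun ℱ hℱ i hi =>
    condExp_bondReveal_ae_eq_integral_of_forestPrefix_T3 F hγ K j hj p e ℱ hℱ _ hV hforest i hi⟩

end T3

end Summit.QuantumFields.YangMills.Theorems.RevelationMartingaleTreeGauge
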